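import Mathlib
import Summits.CriticalPhenomena.CardyFormulaZ2.Theorems.CardyMagicRigidityMagicFormulaTUVAssemblyCore
import Summits.CriticalPhenomena.CardyFormulaZ2.Theorems.CardyMagicRigidityNestingRigidityBigLoopsExpMomentMeet
import HarnessLib

/-!
# Stub S5 `stub_uvAssembly` (crux `MagicFormulaT`, line `Sketch` v6) — small loops are negligible, assembled

Crux `Summit.CriticalPhenomena.CardyFormulaZ2.Theses.CardyMagicRigidity.MagicFormulaT`
(stmt-CriticalPhenomena-4836), line `Sketch`, skeleton v6 (the UV split), registered stub S5.  Part 3/3 of the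
assembly (part 1: `…MagicFormulaTUVAssemblyToolkit`, part 2: `…MagicFormulaTUVAssemblyCore`).

**Statement.** From the band exponential moments (S1), the band first moments (S2), the pathwise split (S4a)
and the pathwise sandwich (S4b) — all four landed on both lattice ensembles — and, for the ensemble `E` at hand,
the exact band centring (S3), it follows that for every admissible `f` and `κ > 0`, for all small cut-offs `η`
and then all small meshes `δ`, `|Λ^{≥0}_δ(f) − Λ^{≥η}_δ(f)| ≤ κ` (`Λ^{≥η}_δ = truncNestingTransform E.P (E.X δ) f η`):
hypotheses (Z) (`E = zEns`) and (T) (`E = tEns`) of `transferContinuity_of_truncation`.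

**Proof.** Fix `f` (`|f| ≤ C`, `f = 0` off `B̄(0,R)`, `∫ f = 0`), `κ₁ = πC`, `ρ = |R| + 2`, `r₀ = r₀(C)`.
Pathwise (S4a/S4b): `A = W_η S`, `W_η = T M`, `|T| ≤ 2^N`, `L_s ≤ S ≤ U_s`, `0 < L_m ≤ M ≤ U_m` with
`U_s = e^{−√3Θ_s}`, `L_s = e^{−√3Θ_s − Θ₂/c}`, `U_m = e^{−√3Θ_m}`.  Hence `|A − W_η| ≤ (t/2)W_η² + (1/2t)G`,
`G = (L_s − 1)² + (U_s − 1)²`, and `W_η² ≤ (16^{N'} + e^{−4√3Θ_m})/2`.  Integrating: `∫W_η² ≤ B` uniformly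
(K6-meet `expMoment_ncard_bigLoops_meeting_le` and S1 at cut-off `r₀`, `EΘ_m = 0` by centring), and
`∫G ≤ (e^{v(η)} − 1) + (e^{v(η)} − 2e^{−m(η)} + 1) → 0`: `∫U_s² ≤ e^{v}` (S1, `EΘ_s = 0`), `∫U_s ≥ 1` and
`∫L_s ≥ e^{−EΘ₂/c} ≥ e^{−m}` (Jensen `exp_integral_le_integral_exp`, S2).  With `t = κ/(B+1)` the two terms are
`≤ κ/2` each once `η` is small.  No definition, no cited fact.
-/

noncomputable section

namespace Summit.CriticalPhenomena.CardyFormulaZ2.Cruxes.MagicFormulaT.LineSketch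

open MeasureTheory Filter Set Metric
open scoped Real Topology BigOperators
open Literature.Probability.RandomPlanarGeometry Literature.Probability.Percolation
  Literature.Probability.LatticeModels
open Summit.CriticalPhenomena.CardyFormulaZ2.Cruxes.NestingRigidity.RingCloudTomography
open Summit.CriticalPhenomena.CardyFormulaZ2.Cruxes.NestingRigidity.PositiveConeWeightDoubling

/-- **Stub S5 (`UVAssembly`).**  See the module docstring. -/
theorem stub_uvAssembly :
    (∀ E ∈ latticeEnsembles, ∀ A : ℝ, ∃ K₀ : ℝ, 0 < K₀ ∧
      ∀ (x₀ : ℂ) (ρ κ a δ η : ℝ) (D : Set ℂ) (g : UnbasedLoop ℂ → ℝ),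
        0 < δ → δ ≤ η → η ≤ ρ → 0 ≤ κ → D ⊆ Metric.ball x₀ ρ →
        (∀ u : UnbasedLoop ℂ, u.range ⊆ D → |g u| ≤ κ * Metric.diam u.range ^ 2) →
        (∀ u : UnbasedLoop ℂ, u.range ⊆ D → η ≤ Metric.diam u.range → g u = 0) →
        |a| * κ * ρ ^ 2 ≤ A →
        Integrable (fun ω ↦ Real.exp (a * ((∑ᶠ u ∈ {u ∈ (E.X δ ω).loops | u.range ⊆ D}, g u) -
          ∫ ω', (∑ᶠ u ∈ {u ∈ (E.X δ ω').loops | u.range ⊆ D}, g u) ∂E.P))) E.P ∧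
        ∫ ω, Real.exp (a * ((∑ᶠ u ∈ {u ∈ (E.X δ ω).loops | u.range ⊆ D}, g u) -
          ∫ ω', (∑ᶠ u ∈ {u ∈ (E.X δ ω').loops | u.range ⊆ D}, g u) ∂E.P)) ∂E.P ≤
          Real.exp (K₀ * a ^ 2 * κ ^ 2 * ρ ^ 3 * η)) →
    (∀ E ∈ latticeEnsembles, ∃ K₁ : ℝ, 0 < K₁ ∧
      ∀ (x₀ : ℂ) (ρ κ δ η : ℝ) (D : Set ℂ) (g : UnbasedLoop ℂ → ℝ),
        0 < δ → δ ≤ η → η ≤ ρ → 0 ≤ κ → D ⊆ Metric.ball x₀ ρ →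
        (∀ u : UnbasedLoop ℂ, u.range ⊆ D → |g u| ≤ κ * Metric.diam u.range ^ 4) →
        (∀ u : UnbasedLoop ℂ, u.range ⊆ D → η ≤ Metric.diam u.range → g u = 0) →
        Integrable (fun ω ↦ ∑ᶠ u ∈ {u ∈ (E.X δ ω).loops | u.range ⊆ D}, g u) E.P ∧
        ∫ ω, |∑ᶠ u ∈ {u ∈ (E.X δ ω).loops | u.range ⊆ D}, g u| ∂E.P ≤ K₁ * κ * ρ ^ 2 * η ^ 2) →
    (∀ E ∈ latticeEnsembles, ∀ (f : ℂ → ℝ) (R C : ℝ), Measurable f → (∀ z, |f z| ≤ C) →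
      (∀ z, R < ‖z‖ → f z = 0) → ∫ z, f z = 0 →
      ∀ (δ η r : ℝ), 0 < δ → 0 < η → η ≤ r → ∀ ω : E.Ω,
        (E.X δ ω).nestingWeight f =
          (E.X δ ω).truncNestingWeight f η *
            ∏ᶠ u ∈ {u ∈ (E.X δ ω).loops | Metric.diam u.range < η}, u.nestingFactor f ∧
        (E.X δ ω).truncNestingWeight f η =
          (E.X δ ω).truncNestingWeight f r *
            ∏ᶠ u ∈ {u ∈ (E.X δ ω).loops | η ≤ Metric.diam u.range ∧ Metric.diam u.range < r},
              u.nestingFactor f ∧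
        |(E.X δ ω).truncNestingWeight f r| ≤
          (2 : ℝ) ^ {u ∈ (E.X δ ω).loops | (u.range ∩ Metric.closedBall (0 : ℂ) R).Nonempty ∧
            r ≤ Metric.diam u.range}.ncard) →
    (∀ E ∈ latticeEnsembles, ∀ (f : ℂ → ℝ) (R C : ℝ), Measurable f →
      (∀ z, |f z| ≤ C) → (∀ z, R < ‖z‖ → f z = 0) → ∫ z, f z = 0 →
      ∀ (δ a b : ℝ), 0 < δ → 0 ≤ a → a ≤ b → b ≤ min 1 (1 / (2 * Real.sqrt (3 * max C 1))) →
      ∀ ω : E.Ω,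
        (∑ᶠ u ∈ {u ∈ (E.X δ ω).loops | a ≤ Metric.diam u.range ∧ Metric.diam u.range < b},
            u.nestingPhase f) =
          ∑ᶠ u ∈ {u ∈ (E.X δ ω).loops | u.range ⊆ Metric.ball (0 : ℂ) (|R| + 2)},
            (if a ≤ Metric.diam u.range ∧ Metric.diam u.range < b then u.nestingPhase f else 0) ∧
        Real.exp (-(Real.sqrt 3 *
              ∑ᶠ u ∈ {u ∈ (E.X δ ω).loops | u.range ⊆ Metric.ball (0 : ℂ) (|R| + 2)},
                (if a ≤ Metric.diam u.range ∧ Metric.diam u.range < b then u.nestingPhase f else 0)) -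
            (∑ᶠ u ∈ {u ∈ (E.X δ ω).loops | u.range ⊆ Metric.ball (0 : ℂ) (|R| + 2)},
                (if a ≤ Metric.diam u.range ∧ Metric.diam u.range < b then u.nestingPhase f ^ 2
                  else 0)) / Real.cos (π / 12 + π / 3)) ≤
          ∏ᶠ u ∈ {u ∈ (E.X δ ω).loops | a ≤ Metric.diam u.range ∧ Metric.diam u.range < b},
            u.nestingFactor f ∧
        ∏ᶠ u ∈ {u ∈ (E.X δ ω).loops | a ≤ Metric.diam u.range ∧ Metric.diam u.range < b},
            u.nestingFactor f ≤
          Real.exp (-(Real.sqrt 3 *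
              ∑ᶠ u ∈ {u ∈ (E.X δ ω).loops | u.range ⊆ Metric.ball (0 : ℂ) (|R| + 2)},
                (if a ≤ Metric.diam u.range ∧ Metric.diam u.range < b then u.nestingPhase f else 0)))) →
    ∀ E ∈ latticeEnsembles,
      (∀ (f : ℂ → ℝ) (R C δ η : ℝ), Measurable f → (∀ z, |f z| ≤ C) → (∀ z, R < ‖z‖ → f z = 0) →
        ∫ z, f z = 0 → 0 < δ →
        ∫ ω, (∑ᶠ u ∈ {u ∈ (E.X δ ω).loops | Metric.diam u.range < η}, u.nestingPhase f) ∂E.P = 0) →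
      ∀ (f : ℂ → ℝ) (R C : ℝ), Measurable f → (∀ z, |f z| ≤ C) → (∀ z, R < ‖z‖ → f z = 0) →
        ∫ z, f z = 0 → ∀ κ : ℝ, 0 < κ → ∀ᶠ η in 𝓝[>] (0 : ℝ), ∀ᶠ δ in 𝓝[>] (0 : ℝ),
          |truncNestingTransform E.P (E.X δ) f 0 - truncNestingTransform E.P (E.X δ) f η| ≤ κ := by
  intro H1 H2 H4a H4b E hE HC f R C hf hC hR h0 κ₀ hκ₀
  haveI := isProbabilityMeasure_of_mem hE
  /- ### constants attached to `f` -/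
  have hC0 : 0 ≤ C := nonneg_of_abs_le hC
  set r₀ : ℝ := min 1 (1 / (2 * Real.sqrt (3 * max C 1))) with hr₀_def
  have hr₀pos : 0 < r₀ := by
    have : 0 < Real.sqrt (3 * max C 1) := Real.sqrt_pos.2 (by positivity)
    exact lt_min one_pos (by positivity)
  have hr₀1 : r₀ ≤ 1 := min_le_left _ _
  have hρ2 : (2 : ℝ) ≤ |R| + 2 := by have := abs_nonneg R; linarith
  have hρpos : (0 : ℝ) < |R| + 2 := by linarith
  set κ₁ : ℝ := π * C with hκ₁_def
  have hκ₁ : 0 ≤ κ₁ := by positivity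
  set cc : ℝ := Real.cos (π / 12 + π / 3) with hcc_def
  have hcc : 0 < cc := Real.cos_pos_of_mem_Ioo ⟨by linarith [Real.pi_pos], by linarith [Real.pi_pos]⟩
  /- ### the constants of S1, S2 and of the keystone K6-meet -/
  obtain ⟨K₀, hK₀, hS1⟩ := H1 E hE (4 * Real.sqrt 3 * κ₁ * (|R| + 2) ^ 2)
  obtain ⟨K₁, hK₁, hS2⟩ := H2 E hE
  obtain ⟨CK, c₀, hCK, hc₀, hK6⟩ := expMoment_ncard_bigLoops_meeting_le E hE (Real.log 16) (max |R| 1)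
    r₀ hr₀pos (hr₀1.trans (le_max_right _ _))
  set EM : ℝ := Real.exp (K₀ * (4 * Real.sqrt 3) ^ 2 * κ₁ ^ 2 * (|R| + 2) ^ 3 * r₀) with hEM_def
  set B : ℝ := (CK + EM) / 2 with hB_def
  have hBpos : 0 < B := by positivity
  set v : ℝ := K₀ * (2 * Real.sqrt 3) ^ 2 * κ₁ ^ 2 * (|R| + 2) ^ 3 with hv_def
  have hτ : 0 < κ₀ ^ 2 / (B + 1) := by positivity
  /- ### the cut-off: error function below `κ₀²/(B+1)`, and `0 < η < r₀` -/
  have hevη : ∀ᶠ η in 𝓝[>] (0 : ℝ), (Real.exp (v * η) - 1) +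
      (Real.exp (v * η) - 2 * Real.exp (-(K₁ * κ₁ ^ 2 * (|R| + 2) ^ 2 * η ^ 2 / cc)) + 1) <
        κ₀ ^ 2 / (B + 1) :=
    (uva_errorFun_tendsto v (K₁ * κ₁ ^ 2 * (|R| + 2) ^ 2) cc).eventually (Iio_mem_nhds hτ)
  filter_upwards [hevη, Ioo_mem_nhdsGT hr₀pos] with η hφ hηI
  have hη0 : 0 < η := hηI.1
  have hηr₀ : η < r₀ := hηI.2
  have hηρ : η ≤ |R| + 2 := by linarith
  /- ### the mesh: `0 < δ ≤ η` and `c₀ δ ≤ r₀` -/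
  filter_upwards [Ioo_mem_nhdsGT (lt_min hη0 (div_pos hr₀pos hc₀))] with δ hδI
  have hδ0 : 0 < δ := hδI.1
  have hδη : δ ≤ η := (hδI.2.trans_le (min_le_left _ _)).le
  have hδc : c₀ * δ ≤ r₀ := by
    have h := (hδI.2.trans_le (min_le_right _ _)).le
    rwa [le_div_iff₀ hc₀, mul_comm] at h
  have hδr₀ : δ ≤ r₀ := hδη.trans hηr₀.le
  /- ### pathwise data at mesh `δ` (S4a with `r = r₀`, S4b on `[0, η)`, `[η, r₀)`, `[0, r₀)`) -/
  have hP := H4a E hE f R C hf hC hR h0 δ η r₀ hδ0 hη0 hηr₀.le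
  have hQs := H4b E hE f R C hf hC hR h0 δ 0 η hδ0 le_rfl hη0.le hηr₀.le
  have hQm := H4b E hE f R C hf hC hR h0 δ η r₀ hδ0 hη0.le hηr₀.le le_rfl
  have hQr := H4b E hE f R C hf hC hR h0 δ 0 r₀ hδ0 le_rfl hr₀pos.le le_rfl
  /- ### the statistics -/
  set A : E.Ω → ℝ := fun ω ↦ (E.X δ ω).truncNestingWeight f 0 with hA_def
  set W : E.Ω → ℝ := fun ω ↦ (E.X δ ω).truncNestingWeight f η with hW_def
  set T : E.Ω → ℝ := fun ω ↦ (E.X δ ω).truncNestingWeight f r₀ with hT_def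
  set Sf : E.Ω → ℝ := fun ω ↦ ∏ᶠ u ∈ {u ∈ (E.X δ ω).loops | diam u.range < η}, u.nestingFactor f
    with hSf_def
  set Mf : E.Ω → ℝ := fun ω ↦
    ∏ᶠ u ∈ {u ∈ (E.X δ ω).loops | η ≤ diam u.range ∧ diam u.range < r₀}, u.nestingFactor f
    with hMf_def
  set Θs : E.Ω → ℝ := fun ω ↦ ∑ᶠ u ∈ {u ∈ (E.X δ ω).loops | u.range ⊆ Metric.ball (0 : ℂ) (|R| + 2)},
    (if 0 ≤ diam u.range ∧ diam u.range < η then u.nestingPhase f else 0) with hΘs_def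
  set Θ₂ : E.Ω → ℝ := fun ω ↦ ∑ᶠ u ∈ {u ∈ (E.X δ ω).loops | u.range ⊆ Metric.ball (0 : ℂ) (|R| + 2)},
    (if 0 ≤ diam u.range ∧ diam u.range < η then u.nestingPhase f ^ 2 else 0) with hΘ₂_def
  set Θm : E.Ω → ℝ := fun ω ↦ ∑ᶠ u ∈ {u ∈ (E.X δ ω).loops | u.range ⊆ Metric.ball (0 : ℂ) (|R| + 2)},
    (if η ≤ diam u.range ∧ diam u.range < r₀ then u.nestingPhase f else 0) with hΘm_def
  set Θr : E.Ω → ℝ := fun ω ↦ ∑ᶠ u ∈ {u ∈ (E.X δ ω).loops | u.range ⊆ Metric.ball (0 : ℂ) (|R| + 2)},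
    (if 0 ≤ diam u.range ∧ diam u.range < r₀ then u.nestingPhase f else 0) with hΘr_def
  set Nt : E.Ω → ℕ := fun ω ↦ {u ∈ (E.X δ ω).loops |
    (u.range ∩ Metric.closedBall (0 : ℂ) (max |R| 1)).Nonempty ∧ r₀ ≤ diam u.range}.ncard with hNt_def
  /- ### pathwise facts -/
  have hAW : ∀ ω, A ω = W ω * Sf ω := fun ω ↦ by
    show (E.X δ ω).truncNestingWeight f 0 = _
    rw [LoopConfig.truncNestingWeight_zero]
    exact (hP ω).1
  have hWTM : ∀ ω, W ω = T ω * Mf ω := fun ω ↦ (hP ω).2.1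
  have hT : ∀ ω, |T ω| ≤ (2 : ℝ) ^ Nt ω := fun ω ↦
    ((hP ω).2.2).trans (pow_le_pow_right₀ one_le_two (uva_ncard_top_le E hE hδ0 ω R r₀))
  have hSl : ∀ ω, Real.exp (-(Real.sqrt 3 * Θs ω) - Θ₂ ω / cc) ≤ Sf ω := fun ω ↦ by
    have h := (hQs ω).2.1
    rw [uva_sep_band_zero] at h
    exact h
  have hSu : ∀ ω, Sf ω ≤ Real.exp (-(Real.sqrt 3 * Θs ω)) := fun ω ↦ by
    have h := (hQs ω).2.2
    rw [uva_sep_band_zero] at h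
    exact h
  have hM0 : ∀ ω, 0 ≤ Mf ω := fun ω ↦ (Real.exp_pos _).le.trans (hQm ω).2.1
  have hMu : ∀ ω, Mf ω ≤ Real.exp (-(Real.sqrt 3 * Θm ω)) := fun ω ↦ (hQm ω).2.2
  have hΘ₂0 : ∀ ω, 0 ≤ Θ₂ ω := fun ω ↦
    finsum_nonneg fun u ↦ finsum_nonneg fun _ ↦ by split_ifs <;> positivity
  /- ### dominations of the band statistics (inputs of S1 / S2) -/
  have hdom : ∀ (a b : ℝ) (u : UnbasedLoop ℂ), u.range ⊆ Metric.ball (0 : ℂ) (|R| + 2) →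
      |(if a ≤ diam u.range ∧ diam u.range < b then u.nestingPhase f else 0)| ≤
        κ₁ * diam u.range ^ 2 := fun a b u _ ↦ uva_band_dom_sq hC hR a b u
  have hdom4 : ∀ (a b : ℝ) (u : UnbasedLoop ℂ), u.range ⊆ Metric.ball (0 : ℂ) (|R| + 2) →
      |(if a ≤ diam u.range ∧ diam u.range < b then u.nestingPhase f ^ 2 else 0)| ≤
        κ₁ ^ 2 * diam u.range ^ 4 := fun a b u _ ↦ uva_band_dom_four hC hR a b u
  have hvan : ∀ (a b : ℝ) (u : UnbasedLoop ℂ), u.range ⊆ Metric.ball (0 : ℂ) (|R| + 2) →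
      b ≤ diam u.range →
      (if a ≤ diam u.range ∧ diam u.range < b then u.nestingPhase f else 0) = 0 :=
    fun a b u _ hb ↦ uva_band_vanish hb _
  have hvan4 : ∀ (a b : ℝ) (u : UnbasedLoop ℂ), u.range ⊆ Metric.ball (0 : ℂ) (|R| + 2) →
      b ≤ diam u.range →
      (if a ≤ diam u.range ∧ diam u.range < b then u.nestingPhase f ^ 2 else 0) = 0 :=
    fun a b u _ hb ↦ uva_band_vanish hb _
  /- ### integrability and measurability of the band statistics -/
  have hIs : Integrable Θs E.P :=
    uva_integrable_inner E hE hδ0 0 2 _ _ hρpos.le hκ₁ subset_rfl (hdom 0 η)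
  have hIr : Integrable Θr E.P :=
    uva_integrable_inner E hE hδ0 0 2 _ _ hρpos.le hκ₁ subset_rfl (hdom 0 r₀)
  have hI2 : Integrable Θ₂ E.P ∧ ∫ ω, |Θ₂ ω| ∂E.P ≤ K₁ * κ₁ ^ 2 * (|R| + 2) ^ 2 * η ^ 2 :=
    hS2 0 (|R| + 2) (κ₁ ^ 2) δ η _ _ hδ0 hδη hηρ (by positivity) subset_rfl (hdom4 0 η) (hvan4 0 η)
  have hΘsm : Measurable Θs :=
    FirstMoment.measurable_finsum_loops_sep E hE δ (fun u ↦ u.range ⊆ Metric.ball (0 : ℂ) (|R| + 2)) _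
  have hΘ₂m : Measurable Θ₂ :=
    FirstMoment.measurable_finsum_loops_sep E hE δ (fun u ↦ u.range ⊆ Metric.ball (0 : ℂ) (|R| + 2)) _
  /- ### centring: `E Θ_s = 0`, `E Θ_r = 0`, hence `E Θ_m = 0` -/
  have hcs : ∫ ω, Θs ω ∂E.P = 0 := by
    refine Eq.trans (integral_congr_ae (Eventually.of_forall fun ω ↦ ?_)) (HC f R C δ η hf hC hR h0 hδ0)
    show Θs ω = _
    rw [← uva_sep_band_zero]
    exact ((hQs ω).1).symm
  have hcr : ∫ ω, Θr ω ∂E.P = 0 := by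
    refine Eq.trans (integral_congr_ae (Eventually.of_forall fun ω ↦ ?_)) (HC f R C δ r₀ hf hC hR h0 hδ0)
    show Θr ω = _
    rw [← uva_sep_band_zero]
    exact ((hQr ω).1).symm
  have hcm : ∫ ω, Θm ω ∂E.P = 0 := by
    have hsplit : ∀ ω, Θm ω = Θr ω - Θs ω := by
      intro ω
      have hm := (hQm ω).1
      have hr := (hQr ω).1
      have hs := (hQs ω).1
      rw [uva_sep_band_zero] at hr hs
      rw [uva_finsum_small_split E hE f R hδ0 hR h0 ω hηr₀.le, hs] at hr
      simp only [hΘm_def, hΘr_def, hΘs_def]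
      rw [← hm, ← hr]
      ring
    rw [integral_congr_ae (Eventually.of_forall hsplit), integral_sub hIr hIs, hcr, hcs, sub_zero]
  -- the same two identities with the statistics displayed (for rewriting inside S1's conclusions)
  have hcs' : ∫ ω, (∑ᶠ u ∈ {u ∈ (E.X δ ω).loops | u.range ⊆ Metric.ball (0 : ℂ) (|R| + 2)},
      (if 0 ≤ diam u.range ∧ diam u.range < η then u.nestingPhase f else 0)) ∂E.P = 0 := hcs
  have hcm' : ∫ ω, (∑ᶠ u ∈ {u ∈ (E.X δ ω).loops | u.range ⊆ Metric.ball (0 : ℂ) (|R| + 2)},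
      (if η ≤ diam u.range ∧ diam u.range < r₀ then u.nestingPhase f else 0)) ∂E.P = 0 := hcm
  /- ### exponential moments (S1): `U_s`, `U_s²`, `e^{−4√3 Θ_m}` -/
  have habs1 : |(-Real.sqrt 3)| ≤ 4 * Real.sqrt 3 := by
    rw [abs_neg, abs_of_nonneg (Real.sqrt_nonneg 3)]; linarith [Real.sqrt_nonneg 3]
  have habs2 : |(-(2 * Real.sqrt 3))| ≤ 4 * Real.sqrt 3 := by
    rw [abs_neg, abs_of_nonneg (by positivity)]; linarith [Real.sqrt_nonneg 3]
  have habs4 : |(-(4 * Real.sqrt 3))| ≤ 4 * Real.sqrt 3 := by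
    rw [abs_neg, abs_of_nonneg (by positivity)]
  have hS1s := hS1 0 (|R| + 2) κ₁ (-Real.sqrt 3) δ η _ _ hδ0 hδη hηρ hκ₁ subset_rfl (hdom 0 η)
    (hvan 0 η) (uva_order_le habs1 hκ₁)
  have hS1s2 := hS1 0 (|R| + 2) κ₁ (-(2 * Real.sqrt 3)) δ η _ _ hδ0 hδη hηρ hκ₁ subset_rfl
    (hdom 0 η) (hvan 0 η) (uva_order_le habs2 hκ₁)
  have hS1m := hS1 0 (|R| + 2) κ₁ (-(4 * Real.sqrt 3)) δ r₀ _ _ hδ0 hδr₀ (by linarith) hκ₁ subset_rfl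
    (hdom η r₀) (hvan η r₀) (uva_order_le habs4 hκ₁)
  have hIU : Integrable (fun ω ↦ Real.exp (-(Real.sqrt 3 * Θs ω))) E.P := by
    have h := hS1s.1
    simp only [hcs', sub_zero, neg_mul] at h
    exact h
  have hIU2 : Integrable (fun ω ↦ Real.exp (-(2 * Real.sqrt 3 * Θs ω))) E.P := by
    have h := hS1s2.1
    simp only [hcs', sub_zero, neg_mul] at h
    exact h
  have hEU2 : ∫ ω, Real.exp (-(2 * Real.sqrt 3 * Θs ω)) ∂E.P ≤ Real.exp (v * η) := by
    have h := hS1s2.2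
    simp only [hcs', sub_zero, neg_mul] at h
    refine h.trans (le_of_eq ?_)
    congr 1
    rw [hv_def]; ring
  have hIM4 : Integrable (fun ω ↦ Real.exp (-(4 * Real.sqrt 3 * Θm ω))) E.P := by
    have h := hS1m.1
    simp only [hcm', sub_zero, neg_mul] at h
    exact h
  have hEM4 : ∫ ω, Real.exp (-(4 * Real.sqrt 3 * Θm ω)) ∂E.P ≤ EM := by
    have h := hS1m.2
    simp only [hcm', sub_zero, neg_mul] at h
    refine h.trans (le_of_eq ?_)
    rw [hEM_def]
    congr 1
    ring
  /- ### the keystone K6-meet at this mesh -/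
  have hK6δ := hK6 δ hδ0 hδc
  have hIN : Integrable (fun ω ↦ Real.exp (Real.log 16 * (Nt ω : ℝ))) E.P := hK6δ.1
  have hEN : ∫ ω, Real.exp (Real.log 16 * (Nt ω : ℝ)) ∂E.P ≤ CK := hK6δ.2
  /- ### the abstract core and the final arithmetic -/
  have key := uva_abstract (μ := E.P) (A := A) (W := W) (S := Sf) (T := T) (M := Mf) (Θs := Θs)
    (Θ₂ := Θ₂) (Θm := Θm) (N := Nt) (t := κ₀ / (B + 1)) (cc := cc) (CK := CK) (EM := EM)
    (V := v * η) (mm := K₁ * κ₁ ^ 2 * (|R| + 2) ^ 2 * η ^ 2) (by positivity) hcc hAW hWTM hT hSl hSu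
    hM0 hMu hΘ₂0 (uva_integrable_truncNestingWeight E hE hδ0 hR h0 0)
    (uva_integrable_truncNestingWeight E hE hδ0 hR h0 η) hΘsm hΘ₂m hIN hEN hIM4 hEM4 hIU hIU2 hEU2
    hIs hcs hI2.1 ((le_abs_self _).trans ((abs_integral_le_integral_abs).trans hI2.2))
  unfold truncNestingTransform
  exact key.trans (uva_final_arith hκ₀ hBpos hφ.le)

end Summit.CriticalPhenomena.CardyFormulaZ2.Cruxes.MagicFormulaT.LineSketch

end
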